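import Summits.MatrixMultiplication.MatrixMultiplication.Theses.DefinableSTPPDichotomy
import Summits.MatrixMultiplication.MatrixMultiplication.Theorems.PairwiseCurvedTilingsLC.Negative.LonelyTranslates
import Summits.MatrixMultiplication.MatrixMultiplication.Theorems.PairwiseCurvedTilingsLC.Negative.ShadowFormulaRealize
import Summits.MatrixMultiplication.MatrixMultiplication.Theorems.PairwiseCurvedTilingsLC.Negative.EtaleBasis
import Summits.MatrixMultiplication.MatrixMultiplication.Theorems.PairwiseCurvedTilingsLC.Negative.NoLonelyInterior
import Summits.MatrixMultiplication.MatrixMultiplication.Theorems.PairwiseCurvedTilingsLC.Negative.UniformBound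
import Summits.MatrixMultiplication.MatrixMultiplication.Theorems.PairwiseCurvedTilingsLC.Negative.ShadowCounting
import Summits.MatrixMultiplication.MatrixMultiplication.Theorems.PairwiseCurvedTilingsLC.Negative.LonelyShadowFormula
import Literature.ModelTheory.PseudofiniteFields.AlgebraicBoundedness
import Literature.ModelTheory.PseudofiniteFields.EtaleOpenTopology
import Literature.ModelTheory.PseudofiniteFields.DefinableExponentialSums
import Literature.ModelTheory.PseudofiniteFields.FiniteFieldTheory

/-!
# `PairwiseCurvedTilingsLC` (crux stmt-MatrixMultiplication-17883) is FALSE — conditionally on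
# three published named facts (line LonelyTranslates, lead's composition)

`not_PairwiseCurvedTilingsLC_of_facts :
  JohnsonTranWalsbergYe2024_thm71_psf → WalsbergYe2023_thmC_psf →
  ChatzidakisVanDenDriesMacintyre1992_mainTheorem → ¬ PairwiseCurvedTilingsLC`.

The three hypotheses are NAMED FACTS of `Literature/ModelTheory/PseudofiniteFields/`:
Johnson–Tran–Walsberg–Ye 2024, Thm 7.1 (no smooth point of a positive-dimensional variety over a
large — e.g. pseudo-finite — field is étale-isolated; pseudo-finite special case, standard-smooth
rendering), Walsberg–Ye 2023, Thm C (1)/D (definable sets in a pseudo-finite field decompose into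
points and étale-open pieces of standard smooth loci), and the Chatzidakis–van den Dries–Macintyre
1992 Main Theorem (itself PROVED in the tree from their Prop. (2.7) and Prop. (3.3),
`ChatzidakisVanDenDriesMacintyre1992_mainTheorem_holds_of`).  So the refutation is conditional
exactly on published theorems of field arithmetic whose formalisation (Lang–Weil, PAC, étale
morphisms) is out of reach; nothing crux-specific is assumed.

## The proof (characteristic-free; the crux's `char F → ∞` is not even used)

1. (`porosityShadowBound_of_facts`) `PorosityShadowBound` — for all ring formulas there are
   `C, q₁` such that in every finite field of characteristic `≥ q₁` every realised family
   satisfying pattern `i = j` of the STPP clause has `Σ_{x : |B_x| > C} |A_x||C_x| ≤ C·|F|^{m−1}`: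
   * in a PSEUDO-FINITE field `K` the `A − C` shadow `𝒰 = ⋃_x (A_x − C_x)` is definable
     (`shadowFormula`, `stub_realize_shadowFormula_iff`) so WY-decomposes; pattern `i = j` makes
     every translate of `B_x` through a shadow point LONELY (`lonely_translate`), hence an
     étale-interior shadow point would make the infinite definable `B_x` étale-discrete, against
     JTWY 7.1 — so the shadow over the blocks with infinite `B_x` lies on a hypersurface
     (`stub_noLonelyInterior`, with the basis calculus `stub_etale_basis`);
   * `|B_x| > C ⇒ B_x` infinite, `C = C(φ_B)` (algebraic boundedness,
     `ChatzidakisVanDenDriesMacintyre1992_mainTheorem.infinite_of_injective`);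
   * the conclusion is ONE ring formula `θ_{C,N}(y)` (`stub_exists_lonelyShadowFormula`,
     semantics `LonelyShadowSem`), true at every `y` of every pseudo-finite field for SOME `N`;
     compactness makes `N` uniform (`stub_uniform_bound`), and the tree's transfer
     `FiniteField.eventually_realize_forall_of_pseudoFinite` moves `⋁_{n ≤ N} θ_{C,n}` to all
     finite fields with `|F| ≥ q₀`;
   * in the finite field, Schwartz–Zippel for the box polynomial (`stub_shadow_card_le`) gives
     the bound with constant `max C (mN)`.
2. Ideator k1's PROVED `notLC_of_shadowBound : PorosityShadowBound → ¬ PairwiseCurvedTilingsLC`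
   (three packings, AM–GM with weight `q^{-1/3}`, `ε := 1/(m+1)`).

References: JohnsonTranWalsbergYe2024 (Thm 7.1, Thm A), WalsbergYe2023 (Thm C (1), Thm D),
Pop1996, Ax1968, ChatzidakisVanDenDriesMacintyre1992 (Main Thm, (2.7), (3.3)); crux dir
`Cruxes/PairwiseCurvedTilingsLC/` (NEGATIVE-lonely-translates.md, PICKED.md, Lines/LonelyTranslates.lean).
-/

set_option linter.dupNamespace false  -- `Summit.<S>.<S>.…` is the mandated namespace

namespace Summit.MatrixMultiplication.MatrixMultiplication.Theorems.PairwiseCurvedTilingsLC.Negative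

open Finset
open FirstOrder FirstOrder.Language FirstOrder.Ring
open Literature.ModelTheory.PseudofiniteFields
open Summit.MatrixMultiplication.MatrixMultiplication.Theses.DefinableSTPPDichotomy

section Assembly

variable {e m k : ℕ}

/-- Realisation of the block formula, set form (no finiteness assumptions). -/
theorem realize_blockFormula_iff {K : Type} [Field K] [CompatibleRing K]
    (φA : Language.ring.Formula ((Fin e ⊕ Fin m) ⊕ Fin k)) (x : Fin e → K) (y : Fin k → K)
    (v : Fin m → K) :
    (blockFormula φA).Realize (Sum.elim v (Fin.append x y)) ↔
      φA.Realize (Sum.elim (Sum.elim x v) y) := by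
  rw [blockFormula, Formula.realize_relabel]
  refine Iff.of_eq (congrArg _ ?_)
  funext a
  rcases a with (a | a) | a
  · simp [relabA]
  · simp [relabA]
  · simp [relabA]

/-- The box sum `Σ_β d_β ∏ w_l^{β_l}` is the evaluation of the box polynomial. -/
theorem boxSum_eq_eval {K : Type} [Field K] {N : ℕ} (d : (Fin m → Fin (N + 1)) → K)
    (w : Fin m → K) :
    ∑ β : Fin m → Fin (N + 1), d β * ∏ l : Fin m, w l ^ ((β l : ℕ)) =
      MvPolynomial.eval w (∑ β : Fin m → Fin (N + 1),
        MvPolynomial.monomial (Finsupp.equivFunOnFinite.symm fun l => ((β l : ℕ))) (d β)) := by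
  rw [map_sum]
  refine Finset.sum_congr rfl fun β _ => ?_
  rw [MvPolynomial.eval_monomial]
  congr 1
  rw [Finsupp.prod_fintype]
  · rfl
  · intro i; rw [pow_zero]

/-- Coefficient extraction: a non-zero polynomial of total degree `≤ N` gives a non-zero box
function on exponents `≤ N` with the same evaluations. -/
theorem exists_box_of_ne_zero {K : Type} [Field K] (D : MvPolynomial (Fin m) K) (hD : D ≠ 0)
    {N : ℕ} (hN : D.totalDegree ≤ N) :
    ∃ d : (Fin m → Fin (N + 1)) → K, d ≠ 0 ∧
      ∀ w : Fin m → K, ∑ β : Fin m → Fin (N + 1), d β * ∏ l : Fin m, w l ^ ((β l : ℕ)) =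
        MvPolynomial.eval w D := by
  classical
  -- the box function: coefficients of `D` at exponent vectors in the box
  let toF : (Fin m → Fin (N + 1)) → (Fin m →₀ ℕ) :=
    fun β => Finsupp.equivFunOnFinite.symm fun l => ((β l : ℕ))
  have htoF_inj : Function.Injective toF := by
    intro β β' h
    funext l
    have := congrArg (fun f : Fin m →₀ ℕ => f l) h
    simp only [toF, Finsupp.coe_equivFunOnFinite_symm] at this
    exact Fin.ext this
  refine ⟨fun β => D.coeff (toF β), ?_, fun w => ?_⟩
  · -- non-zero: some monomial in the support has all exponents ≤ totalDegree ≤ N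
    obtain ⟨s, hs⟩ := MvPolynomial.ne_zero_iff.1 hD
    have hsle : ∀ l, s l ≤ N := by
      intro l
      have h1 : s l ≤ s.sum fun _ e => e := by
        by_cases hl : l ∈ s.support
        · exact Finset.single_le_sum (fun _ _ => Nat.zero_le _) hl
        · rw [Finsupp.notMem_support_iff.1 hl]; exact Nat.zero_le _
      have h2 : (s.sum fun _ e => e) ≤ D.totalDegree :=
        MvPolynomial.le_totalDegree (MvPolynomial.mem_support_iff.2 hs)
      omega
    intro hzero
    have := congrFun hzero (fun l => ⟨s l, Nat.lt_succ_of_le (hsle l)⟩)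
    simp only [Pi.zero_apply] at this
    apply hs
    convert this using 2
    ext l
    simp [toF]
  · rw [boxSum_eq_eval]
    congr 1
    -- `D` equals the sum of its box monomials
    symm
    conv_lhs => rw [D.as_sum]
    -- reindex: support ⊆ image of the box
    have hsupp : ∀ s ∈ D.support, ∃ β : Fin m → Fin (N + 1), toF β = s := by
      intro s hs
      have hsle : ∀ l, s l ≤ N := by
        intro l
        have h1 : s l ≤ s.sum fun _ e => e := by
          by_cases hl : l ∈ s.support
          · exact Finset.single_le_sum (fun _ _ => Nat.zero_le _) hl
          · rw [Finsupp.notMem_support_iff.1 hl]; exact Nat.zero_le _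
        have h2 : (s.sum fun _ e => e) ≤ D.totalDegree := MvPolynomial.le_totalDegree hs
        omega
      refine ⟨fun l => ⟨s l, Nat.lt_succ_of_le (hsle l)⟩, ?_⟩
      ext l; simp [toF]
    rw [← Finset.sum_image (f := fun s => MvPolynomial.monomial s (D.coeff s))
      (fun β _ β' _ h => htoF_inj h)]
    apply Finset.sum_subset
    · intro s hs
      obtain ⟨β, rfl⟩ := hsupp s hs
      exact Finset.mem_image.2 ⟨β, Finset.mem_univ _, rfl⟩
    · intro s _ hs
      rw [MvPolynomial.notMem_support_iff.1 hs, map_zero]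

/-- **PorosityShadowBound from the named facts** (the composition of the line). -/
theorem porosityShadowBound_of_facts (h71 : JohnsonTranWalsbergYe2024_thm71_psf)
    (hWY : WalsbergYe2023_thmC_psf) (hCDM : ChatzidakisVanDenDriesMacintyre1992_mainTheorem) :
    PorosityShadowBound := by
  intro e m k φI φA φB φC
  classical
  -- (1) algebraic boundedness constant for the blocks `B_x`
  obtain ⟨C, hC⟩ := hCDM.infinite_of_injective m (e + k) (blockFormula φB)
  -- (2) the encoding formulas
  choose θ hθ using fun N => stub_exists_lonelyShadowFormula e m k φI φA φB φC C N
  -- (3) in every pseudo-finite field, every `y` satisfies some `θ_N`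
  have hpw : ∀ (K : Type) [Field K] [CompatibleRing K] [Infinite K], K ⊨ finiteFieldTheory →
      ∀ y : Fin k → K, ∃ N, (θ N).Realize y := by
    intro K _ _ _ hK y
    -- realised family (as sets)
    set I : Set (Fin e → K) := {x | φI.Realize (Sum.elim x y)} with hIdef
    set A : (Fin e → K) → Set (Fin m → K) := fun x => {v | φA.Realize (Sum.elim (Sum.elim x v) y)}
      with hAdef
    set B : (Fin e → K) → Set (Fin m → K) := fun x => {v | φB.Realize (Sum.elim (Sum.elim x v) y)}
      with hBdef
    set C' : (Fin e → K) → Set (Fin m → K) := fun x => {v | φC.Realize (Sum.elim (Sum.elim x v) y)}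
      with hCdef
    by_cases hpat : ∀ i ∈ I, ∀ k' ∈ I, ∀ s ∈ A k', ∀ s' ∈ A i, ∀ t ∈ B i, ∀ t' ∈ B i,
        ∀ u ∈ C' i, ∀ u' ∈ C' k', (s' - s) + (t' - t) + (u' - u) = 0 →
          i = k' ∧ s = s' ∧ t = t' ∧ u = u'
    swap
    · -- pattern fails: `θ_0` holds vacuously
      refine ⟨0, (hθ 0 K y).2 fun hp => absurd ?_ hpat⟩
      intro i hi k' hk' s hs s' hs' t ht t' ht' u hu u' hu' h0
      exact hp i hi k' hk' s hs s' hs' t ht t' ht' u hu u' hu' h0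
    -- decompositions from WY Thm C
    have hU : ∃ (n : ℕ) (c : Fin n → ℕ) (S : ∀ i, SmoothDatum K m (c i))
        (X : Fin n → Set (Fin m → K)),
        {w | ∃ x ∈ I, ∃ a ∈ A x, ∃ u ∈ C' x, w = a - u} = (⋃ i, X i) ∧
          ∀ i, (X i).Subsingleton ∨ (c i < m ∧ IsEtaleOpenIn K (S i).locus (X i)) := by
      obtain ⟨n, c, S, X, hXU, hX⟩ := hWY K hK m k (shadowFormula φI φA φC) y
      refine ⟨n, c, S, X, ?_, hX⟩
      rw [← hXU]
      ext w
      simp only [Set.mem_setOf_eq, stub_realize_shadowFormula_iff]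
      constructor
      · rintro ⟨x, hx, a, ha, u, hu, rfl⟩
        exact ⟨x, hx, a, ha, u, hu, rfl⟩
      · rintro ⟨x, hx, a, ha, u, hu, rfl⟩
        exact ⟨x, hx, a, ha, u, hu, rfl⟩
    have hBx : ∀ x ∈ I, ∃ (n : ℕ) (c : Fin n → ℕ) (S : ∀ i, SmoothDatum K m (c i))
        (X : Fin n → Set (Fin m → K)),
        B x = (⋃ i, X i) ∧ ∀ i, (X i).Subsingleton ∨ (c i < m ∧ IsEtaleOpenIn K (S i).locus (X i)) := by
      intro x _
      obtain ⟨n, c, S, X, hXU, hX⟩ := hWY K hK m (e + k) (blockFormula φB) (Fin.append x y)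
      refine ⟨n, c, S, X, ?_, hX⟩
      rw [← hXU]
      ext v
      simp only [Set.mem_setOf_eq, realize_blockFormula_iff, hBdef]
    obtain ⟨D, hD0, hDvan⟩ := stub_noLonelyInterior (h71 K hK m) (stub_etale_basis K m)
      I A B C' hpat hU hBx
    obtain ⟨d, hd0, hdev⟩ := exists_box_of_ne_zero D hD0 le_rfl
    refine ⟨D.totalDegree, (hθ _ K y).2 fun _ => ⟨d, hd0, ?_⟩⟩
    intro x hx hw a ha u hu
    obtain ⟨w, hwinj, hw⟩ := hw
    have hinf : (B x).Infinite := by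
      have := hC K hK (Fin.append x y) w hwinj (fun j => (realize_blockFormula_iff φB x y (w j)).2 (hw j))
      simpa [hBdef, realize_blockFormula_iff] using this
    rw [hdev]
    exact hDvan x hx hinf a ha u hu
  -- (4) a uniform index
  obtain ⟨N, hN⟩ := stub_uniform_bound θ hpw
  -- (5) transfer the disjunction `⋁_{n ≤ N} θ_n` to all large finite fields
  set ψ : Language.ring.Formula (Fin k) := BoundedFormula.iSup (fun n : Fin (N + 1) => θ n) with hψ
  have hψK : ∀ (K : Type) [Field K] [CompatibleRing K] [Infinite K], K ⊨ finiteFieldTheory →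
      ∀ y : Fin k → K, ψ.Realize y := by
    intro K _ _ _ hK y
    obtain ⟨n, hn, hreal⟩ := hN K hK y
    rw [hψ, Formula.Realize, BoundedFormula.realize_iSup]
    exact ⟨⟨n, Nat.lt_succ_of_le hn⟩, hreal⟩
  obtain ⟨q₀, hq₀⟩ := FiniteField.eventually_realize_forall_of_pseudoFinite ψ hψK
  -- (6) the finite-field statement
  refine ⟨max C (m * N), q₀, ?_⟩
  intro F _ _ instCR hchar y I A B C' hI hA hB hC hpat
  have hcard : q₀ ≤ Fintype.card F := hchar.trans (ringChar_le_card F)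
  -- realise `ψ` at `y` in the given compatible structure
  have hψF : ψ.Realize y := by
    rw [realize_iff_of_compatibleRing]
    exact hq₀ F hcard y
  rw [hψ, Formula.Realize, BoundedFormula.realize_iSup] at hψF
  obtain ⟨n, hn⟩ := hψF
  have hsem : LonelyShadowSem e m k φI φA φB φC C n F y := (hθ n F y).1 hn
  -- the pattern hypothesis in realised form
  have hpat' : ∀ i, φI.Realize (Sum.elim i y) → ∀ i', φI.Realize (Sum.elim i' y) →
      ∀ s, φA.Realize (Sum.elim (Sum.elim i' s) y) → ∀ s', φA.Realize (Sum.elim (Sum.elim i s') y) →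
      ∀ t, φB.Realize (Sum.elim (Sum.elim i t) y) → ∀ t', φB.Realize (Sum.elim (Sum.elim i t') y) →
      ∀ u, φC.Realize (Sum.elim (Sum.elim i u) y) →
      ∀ u', φC.Realize (Sum.elim (Sum.elim i' u') y) →
        (s' - s) + (t' - t) + (u' - u) = 0 → i = i' ∧ s = s' ∧ t = t' ∧ u = u' := by
    intro i hi i' hi' s hs s' hs' t ht t' ht' u hu u' hu' h0
    exact hpat i ((hI i).2 hi) i' ((hI i').2 hi') s ((hA i' s).2 hs) s' ((hA i s').2 hs')
      t ((hB i t).2 ht) t' ((hB i t').2 ht') u ((hC i u).2 hu) u' ((hC i' u').2 hu') h0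
  obtain ⟨d, hd0, hdvan⟩ := hsem hpat'
  -- the big-`B` blocks
  set Cb : ℕ := max C (m * N) with hCb
  set I₁ := I.filter (fun x => Cb < (B x).card) with hI₁
  have hI₁I : I₁ ⊆ I := filter_subset _ _
  have hpat₁ : ∀ i ∈ I₁, ∀ k' ∈ I₁, ∀ s ∈ A k', ∀ s' ∈ A i, ∀ t ∈ B i, ∀ t' ∈ B i, ∀ u ∈ C' i,
      ∀ u' ∈ C' k', (s' - s) + (t' - t) + (u' - u) = 0 → i = k' ∧ s = s' ∧ t = t' ∧ u = u' :=
    fun i hi k' hk' => hpat i (hI₁I hi) k' (hI₁I hk')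
  have hB₁ : ∀ x ∈ I₁, (B x).Nonempty := fun x hx =>
    card_pos.1 (lt_of_le_of_lt (Nat.zero_le _) (mem_filter.1 hx).2)
  have hvan : ∀ x ∈ I₁, ∀ a ∈ A x, ∀ u ∈ C' x,
      ∑ β : Fin m → Fin (n + 1), d β * ∏ l : Fin m, (a - u) l ^ ((β l : ℕ)) = 0 := by
    intro x hx a ha u hu
    obtain ⟨hxI, hxB⟩ := mem_filter.1 hx
    have hCB : C < (B x).card := lt_of_le_of_lt (le_max_left _ _) hxB
    -- `C + 1` distinct points of `B x`
    obtain ⟨w, hw⟩ : ∃ w : Fin (C + 1) ↪ (Fin m → F), ∀ j, w j ∈ B x := by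
      have h : C + 1 ≤ (B x).card := hCB
      obtain ⟨s, hs, hscard⟩ := Finset.exists_subset_card_eq h
      refine ⟨(Finset.equivFinOfCardEq hscard).symm.toEmbedding.trans
        (Function.Embedding.subtype _), fun j => hs ?_⟩
      exact Finset.coe_mem _
    exact hdvan x ((hI x).1 hxI) ⟨w, w.injective, fun j => (hB x (w j)).1 (hw j)⟩
      a ((hA x a).1 ha) u ((hC x u).1 hu)
  have hle := stub_shadow_card_le I₁ A B C' hpat₁ hB₁ d hd0 hvan
  -- numerics: `m n ≤ m N ≤ Cb`
  have hq0 : (0 : ℝ) ≤ (Fintype.card F : ℝ) ^ ((m : ℝ) - 1) := by positivity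
  calc ((∑ x ∈ I.filter (fun x => Cb < (B x).card), (A x).card * (C' x).card : ℕ) : ℝ)
      ≤ ((m * n : ℕ) : ℝ) * (Fintype.card F : ℝ) ^ ((m : ℝ) - 1) := hle
    _ ≤ (Cb : ℝ) * (Fintype.card F : ℝ) ^ ((m : ℝ) - 1) := by
        apply mul_le_mul_of_nonneg_right _ hq0
        have h1 : m * n ≤ m * N := Nat.mul_le_mul_left m (Nat.lt_succ_iff.1 n.2)
        have h2 : m * N ≤ Cb := le_max_right _ _
        exact_mod_cast h1.trans h2

/-- **The crux is FALSE, conditionally on the named facts** (JTWY 2024 Thm 7.1, WY 2023 Thm C/D —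
pseudo-finite special cases — and the CDM Main Theorem, itself proved in the tree from CDM
Prop. (2.7) and Prop. (3.3)). -/
theorem not_PairwiseCurvedTilingsLC_of_facts (h71 : JohnsonTranWalsbergYe2024_thm71_psf)
    (hWY : WalsbergYe2023_thmC_psf) (hCDM : ChatzidakisVanDenDriesMacintyre1992_mainTheorem) :
    ¬ PairwiseCurvedTilingsLC :=
  notLC_of_shadowBound (porosityShadowBound_of_facts h71 hWY hCDM)

end Assembly

/-- The conjunction of the three named facts the refutation rests on: Johnson–Tran–Walsberg–Ye
2024 Thm 7.1 and Walsberg–Ye 2023 Thm C (1)/D in their pseudo-finite special cases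
(`Literature/ModelTheory/PseudofiniteFields/EtaleOpenTopology.lean`), and the
Chatzidakis–van den Dries–Macintyre 1992 Main Theorem (proved in the tree from their Prop. (2.7)
and Prop. (3.3)).  Discharging it = proving these published theorems. -/
def EtaleOpenFacts : Prop :=
  JohnsonTranWalsbergYe2024_thm71_psf ∧ WalsbergYe2023_thmC_psf ∧
    ChatzidakisVanDenDriesMacintyre1992_mainTheorem

/-- **NEGATIVE LEMMA (the line's result): `EtaleOpenFacts → ¬ PairwiseCurvedTilingsLC`.**
The crux `PairwiseCurvedTilingsLC` of route DefinableSTPPDichotomy is false conditionally on the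
published facts `EtaleOpenFacts`; see the module docstring for the proof. -/
theorem PairwiseCurvedTilingsLC_false_of_EtaleOpenFacts :
    EtaleOpenFacts → ¬ PairwiseCurvedTilingsLC :=
  fun h => not_PairwiseCurvedTilingsLC_of_facts h.1 h.2.1 h.2.2


end Summit.MatrixMultiplication.MatrixMultiplication.Theorems.PairwiseCurvedTilingsLC.Negative
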